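import Summits.AtomisticToContinuum.Crystallization.Theorems.SquareWellLayerCakeGapTwelveToBarlowCombinatorialLayeringClosure
import Summits.AtomisticToContinuum.Crystallization.Theorems.SquareWellLayerCakeGapTwelveToBarlowCombinatorialLayeringDevelopBase

/-!
# Combinatorial layering (B1a of `GapTwelveToBarlow`): H_develop with an existential window constant, modulo GoodFacets and H_inj

Crux `SquareWellLayerCake.GapTwelveToBarlow` (stmt-AtomisticToContinuum-15807), line `Sketch`,
stub `stub_develop` (H_develop).  **`develop_of_goodFacets_of_inj : (GoodFacets) → (H_inj) →
(H_develop with window `C·D`, `C`, `D₀` existential)`** — the recommended (v7) form of the stub,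
proved from two closed residual statements: **GoodFacets** (= `stub_goodFacets` verbatim, feeding
the thick `exists_step` and the extended gap) and **H_inj** (local injectivity / no return of
STAR/LINK developments — the minimal form of orientation coherence).
Proof: with `W = ⌈60 D⌉ + 1`, either an hcp-like site `b` lies within `ρ_A = 140 W + 58` of
`x i` — develop from `b` (`develop_of_base`, hcp regime) with `K = W₀ + 20W + 12`,
`R = 4W₀ + 120W + 47`, `W₀ = 60 ρ_A + 1`, reach `x i` along a bond walk (`exists_walk_of_goodFacets`,
`reach_of_walk`) — or every charted site within `ρ_A` is fcc-like — develop from `x i` itself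
(all-fcc regime, `K = 20W + 10`, `R = 120W + 40`); then `develop_closure`.  Constants:
`C = 10⁷`, `D₀ = 100` (crude; the true window is a small multiple of `D`).
Nothing is defined; no named fact is used.
-/

noncomputable section

namespace Summit.AtomisticToContinuum.Crystallization.Theorems.SquareWellLayerCakeGapTwelveToBarlow

open Literature.Geometry.DiscreteGeometry Literature.MathematicalPhysics.StatisticalMechanics

/-- **The integer scale of the closure** (registered anchor of this file): `n₁ = ⌈60 D⌉` has
`D ≤ n₁/60` and `n₁ ≤ 60 D + 1`. [folklore] -/
theorem scale_ceil_bounds :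
    ∀ D : ℝ, 0 ≤ D → D ≤ (⌈60 * D⌉₊ : ℝ) / 60 ∧ (⌈60 * D⌉₊ : ℝ) ≤ 60 * D + 1 := by
  intro D hD
  constructor
  · have := Nat.le_ceil (60 * D); linarith
  · linarith [Nat.ceil_lt_add_one (show (0:ℝ) ≤ 60 * D by linarith)]

/-- **H_develop (existential window) from GoodFacets and H_inj.** [folklore] -/
theorem develop_of_goodFacets_of_inj :
    (∀ (N : ℕ) (x : Fin N → EuclideanSpace ℝ (Fin 3)) (i : Fin N), (∀ l : Fin N, dist (x i) (x
    l) ≤ 4 → ((∀ j' : Fin N, dist (x l) (x j') ≤ 11 / 10 → ∀ k : Fin N, k ≠ j' → (55 : ℝ) / 57 ≤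
    dist (x j') (x k)) ∧ (Finset.univ.filter fun j' : Fin N => j' ≠ l ∧ dist (x l) (x j') ≤
    1).card = 12 ∧ (Finset.univ.filter fun j' : Fin N => j' ≠ l ∧ dist (x l) (x j') ≤ 11 /
    10).card ≤ 12)) → ∀ (n : EuclideanSpace ℝ (Fin 3)) (a b c : Fin N), (∀ l : Fin N, l ≠ i →
    dist (x i) (x l) ≤ 1 → inner ℝ n (x l - x i) ≤ 1) → a ≠ i → b ≠ i → c ≠ i → a ≠ b → b ≠ c →
    a ≠ c → dist (x i) (x a) ≤ 1 → dist (x i) (x b) ≤ 1 → dist (x i) (x c) ≤ 1 → inner ℝ n (x a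
    - x i) = 1 → inner ℝ n (x b - x i) = 1 → inner ℝ n (x c - x i) = 1 → (dist (x a) (x b) ≤ 1 ∧
    dist (x b) (x c) ≤ 1) ∨ (dist (x b) (x c) ≤ 1 ∧ dist (x c) (x a) ≤ 1) ∨ (dist (x c) (x a) ≤
    1 ∧ dist (x a) (x b) ≤ 1)) → (∀ (N : ℕ) (x : Fin N → EuclideanSpace ℝ (Fin 3)) (s : ℤ → ℤ)
    (Φ : EuclideanSpace ℝ (Fin 3) → Fin N) (c : EuclideanSpace ℝ (Fin 3)) (ρ : ℝ), IsHaggSeq s →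
    c ∈ barlowStacking 1 (Real.sqrt (2 / 3)) s → (∀ j : Fin N, dist (x (Φ c)) (x j) ≤ 3 * ρ + 6
    → ((∀ j' : Fin N, dist (x j) (x j') ≤ 11 / 10 → ∀ k : Fin N, k ≠ j' → (55 : ℝ) / 57 ≤ dist
    (x j') (x k)) ∧ (Finset.univ.filter fun j' : Fin N => j' ≠ j ∧ dist (x j) (x j') ≤ 1).card =
    12 ∧ (Finset.univ.filter fun j' : Fin N => j' ≠ j ∧ dist (x j) (x j') ≤ 11 / 10).card ≤ 12))
    → (∀ p ∈ barlowStacking 1 (Real.sqrt (2 / 3)) s, dist p c ≤ ρ → ((∀ q ∈ barlowStacking 1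
    (Real.sqrt (2 / 3)) s, dist p q = 1 → Φ q ≠ Φ p ∧ dist (x (Φ p)) (x (Φ q)) ≤ 1) ∧ (∀ q ∈
    barlowStacking 1 (Real.sqrt (2 / 3)) s, ∀ q' ∈ barlowStacking 1 (Real.sqrt (2 / 3)) s, dist
    p q = 1 → dist p q' = 1 → Φ q = Φ q' → q = q') ∧ (∀ l : Fin N, l ≠ Φ p → dist (x (Φ p)) (x
    l) ≤ 1 → ∃ q ∈ barlowStacking 1 (Real.sqrt (2 / 3)) s, dist p q = 1 ∧ Φ q = l) ∧ (∀ q ∈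
    barlowStacking 1 (Real.sqrt (2 / 3)) s, ∀ q' ∈ barlowStacking 1 (Real.sqrt (2 / 3)) s, dist
    p q = 1 → dist p q' = 1 → q ≠ q' → (dist (x (Φ q)) (x (Φ q')) ≤ 1 ↔ dist q q' = 1)))) → ∀ p
    ∈ barlowStacking 1 (Real.sqrt (2 / 3)) s, dist p c ≤ ρ / 2 → Φ p = Φ c → p = c) → (∃ C D₀ :
    ℝ, ∀ (N : ℕ) (x : Fin N → EuclideanSpace ℝ (Fin 3)) (i : Fin N) (D : ℝ), D₀ ≤ D → (∀ j : Fin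
    N, dist (x i) (x j) ≤ C * D → ((∀ j' : Fin N, dist (x j) (x j') ≤ 11 / 10 → ∀ k : Fin N, k ≠
    j' → (55 : ℝ) / 57 ≤ dist (x j') (x k)) ∧ (Finset.univ.filter fun j' : Fin N => j' ≠ j ∧
    dist (x j) (x j') ≤ 1).card = 12 ∧ (Finset.univ.filter fun j' : Fin N => j' ≠ j ∧ dist (x j)
    (x j') ≤ 11 / 10).card ≤ 12)) → (∀ j k : Fin N, dist (x i) (x j) ≤ C * D → ¬ (j ≠ k ∧ dist
    (x j) (x k) ≤ 1 ∧ (Finset.univ.filter fun l : Fin N => l ≠ j ∧ l ≠ k ∧ dist (x j) (x l) ≤ 1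
    ∧ dist (x k) (x l) ≤ 1).card = 5)) → (∀ j : Fin N, dist (x i) (x j) + 10 ≤ C * D → ∃ (T :
    Fin 12 → Fin 3 → ℤ) (e : Fin 12 → Fin N), ((((T = fun a : Fin 12 => 3 •
    Literature.Geometry.DiscreteGeometry.fccTab a) ∨ T =
    Literature.Geometry.DiscreteGeometry.hcpTab) ∧ Function.Injective e ∧ (∀ a : Fin 12, e a ≠ j
    ∧ dist (x j) (x (e a)) ≤ 1) ∧ (∀ k : Fin N, k ≠ j → dist (x j) (x k) ≤ 1 → ∃ a : Fin 12, e a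
    = k) ∧ (∀ a b : Fin 12, a ≠ b → (dist (x (e a)) (x (e b)) ≤ 1 ↔
    Literature.Geometry.DiscreteGeometry.sqNormInt (T a - T b) = 18))))) → (∀ (j j' : Fin N) (T
    T' : Fin 12 → Fin 3 → ℤ) (e e' : Fin 12 → Fin N), dist (x i) (x j) + 10 ≤ C * D → dist (x i)
    (x j') + 10 ≤ C * D → j ≠ j' → dist (x j) (x j') ≤ 1 → ((((T = fun a : Fin 12 => 3 •
    Literature.Geometry.DiscreteGeometry.fccTab a) ∨ T =
    Literature.Geometry.DiscreteGeometry.hcpTab) ∧ Function.Injective e ∧ (∀ a : Fin 12, e a ≠ j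
    ∧ dist (x j) (x (e a)) ≤ 1) ∧ (∀ k : Fin N, k ≠ j → dist (x j) (x k) ≤ 1 → ∃ a : Fin 12, e a
    = k) ∧ (∀ a b : Fin 12, a ≠ b → (dist (x (e a)) (x (e b)) ≤ 1 ↔
    Literature.Geometry.DiscreteGeometry.sqNormInt (T a - T b) = 18)))) → ((((T' = fun a : Fin
    12 => 3 • Literature.Geometry.DiscreteGeometry.fccTab a) ∨ T' =
    Literature.Geometry.DiscreteGeometry.hcpTab) ∧ Function.Injective e' ∧ (∀ a : Fin 12, e' a ≠
    j' ∧ dist (x j') (x (e' a)) ≤ 1) ∧ (∀ k : Fin N, k ≠ j' → dist (x j') (x k) ≤ 1 → ∃ a : Fin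
    12, e' a = k) ∧ (∀ a b : Fin 12, a ≠ b → (dist (x (e' a)) (x (e' b)) ≤ 1 ↔
    Literature.Geometry.DiscreteGeometry.sqNormInt (T' a - T' b) = 18)))) → ∀ a a' b b' : Fin
    12, e a = e' b → e a' = e' b' → Literature.Geometry.DiscreteGeometry.sqNormInt (T a - T a')
    = Literature.Geometry.DiscreteGeometry.sqNormInt (T' b - T' b')) → ∃ s : ℤ → ℤ, IsHaggSeq s
    ∧ ∃ φ : Fin N → EuclideanSpace ℝ (Fin 3), (∀ j : Fin N, dist (x i) (x j) ≤ D → φ j ∈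
    barlowStacking 1 (Real.sqrt (2 / 3)) s) ∧ (∀ j j' : Fin N, dist (x i) (x j) ≤ D → dist (x i)
    (x j') ≤ D → j ≠ j' → φ j ≠ φ j') ∧ (∀ j j' : Fin N, dist (x i) (x j) ≤ D → dist (x i) (x
    j') ≤ D → j ≠ j' → (dist (x j) (x j') ≤ 1 ↔ dist (φ j) (φ j') = 1)) ∧ (∀ p ∈ barlowStacking
    1 (Real.sqrt (2 / 3)) s, dist p (φ i) ≤ D / 2 → ∃ j : Fin N, dist (x i) (x j) ≤ D ∧ φ j =
    p)) :=
  by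
  intro hGF hInj
  refine ⟨10000000, 100, ?_⟩
  intro N x i D hD hGood _hFF hCharts hTrans
  classical
  -- the scale `W = ⌈60 D⌉ + 1`
  set n₁ : ℕ := ⌈60 * D⌉₊ with hn₁
  obtain ⟨hDn, hn₁le⟩ : D ≤ (n₁ : ℝ) / 60 ∧ (n₁ : ℝ) ≤ 60 * D + 1 := by
    rw [hn₁]; exact scale_ceil_bounds D (by linarith)
  set W : ℕ := n₁ + 1 with hW
  have hWr : ((W : ℕ) : ℝ) = n₁ + 1 := by rw [hW]; push_cast; ring
  have hWD : (W : ℝ) ≤ 60 * D + 2 := by rw [hWr]; linarith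
  have e2 : 2 * (10000000 * D / 2) = 10000000 * D := by ring
  -- hypotheses at window `2 · (C D / 2)`
  have hGood' : ∀ j : Fin N, dist (x i) (x j) ≤ 2 * (10000000 * D / 2) → _ := fun j hj =>
    hGood j (by linarith)
  have hCharts' : ∀ j : Fin N, dist (x i) (x j) + 10 ≤ 2 * (10000000 * D / 2) → _ := fun j hj =>
    hCharts j (by linarith)
  have hTrans' : ∀ (j j' : Fin N) (T T' : Fin 12 → Fin 3 → ℤ) (e e' : Fin 12 → Fin N),
      dist (x i) (x j) + 10 ≤ 2 * (10000000 * D / 2) → dist (x i) (x j') + 10 ≤ 2 * (10000000 * D / 2) → _ :=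
    fun j j' T T' e e' hj hj' => hTrans j j' T T' e e' (by linarith) (by linarith)
  -- the closure, once a development reaching `x i` is given
  have hGoodC : ∀ j : Fin N, dist (x i) (x j) ≤ 38 * ((n₁ + 1 : ℕ) : ℝ) + 12 → _ := fun j hj =>
    hGood j (by rw [← hW, hWr] at hj; nlinarith)
  -- the case split: an hcp-like site within `ρ_A` of `x i`?
  set KA : ℕ := 20 * W + 10 with hKA
  set RA : ℕ := 120 * W + 40 with hRA
  by_cases hB : ∃ b : Fin N, dist (x i) (x b) ≤ ((0 + KA + 4 + RA : ℕ) : ℝ) ∧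
      ∃ (T : Fin 12 → Fin 3 → ℤ) (e : Fin 12 → Fin N), (((T = fun a : Fin 12 => 3 • fccTab a) ∨ T = hcpTab) ∧ Function.Injective e ∧ (∀ a : Fin 12, e a ≠ b ∧ dist (x b) (x (e a)) ≤ 1) ∧ (∀ k : Fin N, k ≠ b → dist (x b) (x k) ≤ 1 → ∃ a : Fin 12, e a = k) ∧ (∀ a b : Fin 12, a ≠ b → (dist (x (e a)) (x (e b)) ≤ 1 ↔ sqNormInt (T a - T b) = 18))) ∧ T = hcpTab
  · -- CASE B: develop from the hcp-like site `b`
    obtain ⟨b, hbρ, T, e, hc, hT⟩ := hB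
    set ρA : ℕ := 0 + KA + 4 + RA with hρA
    have hρAr : ((ρA : ℕ) : ℝ) = 140 * W + 54 := by rw [hρA, hKA, hRA]; push_cast; ring
    set W₀ : ℕ := 60 * ρA + 1 with hW₀
    have hW₀r : ((W₀ : ℕ) : ℝ) = 60 * ρA + 1 := by rw [hW₀]; push_cast; ring
    set K : ℕ := W₀ + 20 * W + 12 with hK
    set R : ℕ := 4 * W₀ + 120 * W + 47 with hR
    have hlev : dist (x i) (x b) + 10 + ((0 + K + 4 + R : ℕ) : ℝ) ≤ 2 * (10000000 * D / 2) := by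
      have : ((0 + K + 4 + R : ℕ) : ℝ) = 5 * W₀ + 140 * W + 63 := by rw [hK, hR]; push_cast; ring
      rw [this, hW₀r, hρAr]; rw [hρAr] at hbρ; linarith
    obtain ⟨s, hs, Φ, hΦb, hdev⟩ := develop_of_base N x i (10000000 * D / 2) hGood' hCharts' hTrans' b 0 K R
      (by omega) hlev (Or.inl ⟨T, e, hc, hT⟩)
    -- walk from `b` to `i`
    obtain ⟨m, hm, c, hc0, hcm, hcw⟩ := exists_walk_of_goodFacets hGF N x b (60 * ρA) i
      (fun l hl => hGood l (by
        have h1 : ((60 * ρA : ℕ) : ℝ) / 60 = ρA := by push_cast; ring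
        rw [h1] at hl; rw [hρAr] at hbρ hl
        linarith [dist_triangle (x i) (x b) (x l)]))
      (by rw [dist_comm]; push_cast; linarith)
    obtain ⟨k₀, i₀, j₀, hk₀, hsum₀, hΦi⟩ := reach_of_walk N x s Φ b K R hs hΦb
      (fun k i' j' hk hij => (hdev k i' j' hk hij).2.2.2.1) m c hc0 hcw (by omega) (by omega)
    rw [hcm] at hΦi
    obtain ⟨φ, h1, h2, h3, h4⟩ := develop_closure hGF hInj x i D hD n₁ hDn hGoodC hs Φ K R W₀ k₀ i₀ j₀ hΦi (by omega) (by omega)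
      (by omega) (by omega) (fun k i' j' hk hij => (hdev k i' j' hk hij).2)
    exact ⟨s, hs, φ, h1, h2, h3, h4⟩
  · -- CASE A: every charted site within `ρ_A` of `x i` is fcc-like; develop from `x i`
    push Not at hB
    have hlev : dist (x i) (x i) + 10 + ((0 + KA + 4 + RA : ℕ) : ℝ) ≤ 2 * (10000000 * D / 2) := by
      rw [dist_self, hKA, hRA]; push_cast; linarith
    obtain ⟨s, hs, Φ, hΦi, hdev⟩ := develop_of_base N x i (10000000 * D / 2) hGood' hCharts' hTrans' i 0 KA RA
      (by omega) hlev (Or.inr (fun j hj _ T e hc => by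
        rcases hc.1 with h | h
        · exact h
        · exact absurd h (hB j hj T e hc)))
    obtain ⟨φ, h1, h2, h3, h4⟩ := develop_closure hGF hInj x i D hD n₁ hDn hGoodC hs Φ KA RA 0 0 0 0 hΦi (by simp) (by simp)
      (by omega) (by omega) (fun k i' j' hk hij => (hdev k i' j' hk hij).2)
    exact ⟨s, hs, φ, h1, h2, h3, h4⟩

end Summit.AtomisticToContinuum.Crystallization.Theorems.SquareWellLayerCakeGapTwelveToBarlow
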